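import Summits.QuantumFields.QCD.Theorems.HeatSlicedQuarksActionBoundsLowModesStubNaiveKineticAux
import Summits.QuantumFields.QCD.Theorems.ActionBoundsLowModes.Negative.LoadBearing

/-!
# Naive kinetic bound for Wilson fermions, II: commutators of the twisted shifts are plaquette
# defects (auxiliary file for stub `stub_naiveKinetic` of line `Sketch`, crux `ActionBoundsLowModes`,
item stmt-QuantumFields-8872, route route-QuantumFields-HeatSlicedQuarks)

Let `F_μ = linkHop ρ U μ` be the `U`-twisted forward shift on site ⊗ colour space
(`(F_μψ)(x) = ρ(U(x,μ)) ψ(x+μ̂)`), unitary for unitary `ρ`.  This file proves: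
* a small calculus of **monomial** (single site-offset) matrices `((x,a),(y,b)) ↦ δ_{y,x+s} Δ_x(a,b)`
  (products, adjoints, row/column sums) and the Schur-test form bound
  `|⟨w, (Z ⊗ Γ) w⟩| ≤ 4N Σ_x (E(x) + E(x−s)) Σ_{a,α}|w(x,a,α)|²` when `|Δ_x(a,b)| ≤ E(x)` (`norm_form_mon_le`);
* the **commutators are plaquette defects**: `[F_μ, F_ν]` has offset `μ̂+ν̂` and coefficient
  `(ρ(U_{x,μν}) − 1) ρ(U(x,ν)) ρ(U(x+ν̂,μ))`, `[F_μ, F_νᴴ]` has offset `μ̂−ν̂` and coefficient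
  `ρ(U(y,ν))ᴴ (ρ(U_{y,νμ}) − 1) ρ(U(y,μ))`, `y = x − ν̂` (`U_{x,μν} = plaquetteHolonomy U x μ ν`);
* hence, for `SU(3)` in the fundamental representation, each of the four commutator forms
  `|⟨w, ([F_μ^♯, F_ν^♭] ⊗ Γ) w⟩|` (`♯, ♭ ∈ {·, ᴴ}`, `|Γ_{αβ}| ≤ 1`) is at most
  `432 Σ_x V(U,x) Σ_{a,α} |w(x,a,α)|²`, `V(U,x) = Σ_{dist(x,y)≤3} Σ_{μ,ν} √(3 − Re tr U_{y,μν})` the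
  curvature potential of the route (`stub_naiveKineticDefect`, the registered sub-goal, and companions).
Constants are deliberately crude.  No named facts are used.
-/
namespace Summit.QuantumFields.QCD.Cruxes.ActionBoundsLowModes.DropTheWilsonSquare

open Literature.MathematicalPhysics Literature.MathematicalPhysics.QuantumLattice
  Literature.MathematicalPhysics.QuantumFieldTheory Literature.Probability.LatticeModels
open Matrix
open scoped Kronecker ComplexOrder

/-! ## Monomial (single-offset) matrices on site ⊗ colour space -/

section Mon

variable {L N : ℕ} {G : Type*} [Group G] (ρ : G →* Matrix (Fin N) (Fin N) ℂ)

/-- The twisted shift `F_μ` is the monomial with offset `μ̂` and coefficient `x ↦ ρ(U(x,μ))`. -/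
theorem linkHop_eq_mon (U : GaugeConfig 4 L G) (μ : Fin 4) :
    linkHop ρ U μ = Matrix.of fun p q : TorusSite 4 L × Fin N =>
      if q.1 = p.1 + (Pi.single μ 1 : TorusSite 4 L) then ρ (U (p.1, μ)) p.2 q.2 else 0 := rfl

/-- Adjoint of a monomial: offset `−s`, coefficient `x ↦ Δ(x − s)ᴴ`. -/
theorem mon_conjTranspose (s : TorusSite 4 L) (Δ : TorusSite 4 L → Matrix (Fin N) (Fin N) ℂ) :
    (Matrix.of fun p q : TorusSite 4 L × Fin N => if q.1 = p.1 + s then Δ p.1 p.2 q.2 else 0)ᴴ =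
      Matrix.of fun p q : TorusSite 4 L × Fin N =>
        if q.1 = p.1 + -s then (Δ (p.1 - s))ᴴ p.2 q.2 else 0 := by
  ext p q
  simp only [conjTranspose_apply, Matrix.of_apply]
  by_cases h : p.1 = q.1 + s
  · have h' : q.1 = p.1 + -s := by rw [h]; abel
    rw [if_pos h, if_pos h']
    simp [h]
  · have h' : ¬ q.1 = p.1 + -s := fun h' => h (by rw [h']; abel)
    rw [if_neg h, if_neg h', star_zero]

variable [NeZero L]

/-- Product of monomials: offsets add, coefficients multiply along the path. -/
theorem mon_mul (s t : TorusSite 4 L) (Δ E : TorusSite 4 L → Matrix (Fin N) (Fin N) ℂ) :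
    (Matrix.of fun p q : TorusSite 4 L × Fin N => if q.1 = p.1 + s then Δ p.1 p.2 q.2 else 0) *
        (Matrix.of fun p q : TorusSite 4 L × Fin N => if q.1 = p.1 + t then E p.1 p.2 q.2 else 0) =
      Matrix.of fun p q : TorusSite 4 L × Fin N =>
        if q.1 = p.1 + (s + t) then (Δ p.1 * E (p.1 + s)) p.2 q.2 else 0 := by
  ext p q
  simp only [Matrix.mul_apply, Matrix.of_apply, Fintype.sum_prod_type, ite_mul, zero_mul,
    Finset.sum_ite_irrel, Finset.sum_const_zero, Finset.sum_ite_eq', Finset.mem_univ, if_true]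
  by_cases h : q.1 = p.1 + (s + t)
  · simp [h, add_assoc]
  · simp [h, add_assoc]

/-- Row sums of a monomial. -/
theorem sum_norm_mon_row (s : TorusSite 4 L) (Δ : TorusSite 4 L → Matrix (Fin N) (Fin N) ℂ)
    (i : TorusSite 4 L × Fin N) :
    ∑ j, ‖(Matrix.of fun p q : TorusSite 4 L × Fin N =>
        if q.1 = p.1 + s then Δ p.1 p.2 q.2 else 0) i j‖ = ∑ b, ‖Δ i.1 i.2 b‖ := by
  rw [Fintype.sum_prod_type, Finset.sum_eq_single (i.1 + s)]
  · simp
  · intro y _ hy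
    simp [hy]
  · simp

/-- Column sums of a monomial. -/
theorem sum_norm_mon_col (s : TorusSite 4 L) (Δ : TorusSite 4 L → Matrix (Fin N) (Fin N) ℂ)
    (i : TorusSite 4 L × Fin N) :
    ∑ j, ‖(Matrix.of fun p q : TorusSite 4 L × Fin N =>
        if q.1 = p.1 + s then Δ p.1 p.2 q.2 else 0) j i‖ = ∑ a, ‖Δ (i.1 - s) a i.2‖ := by
  rw [Fintype.sum_prod_type, Finset.sum_eq_single (i.1 - s)]
  · simp
  · intro y _ hy
    have : ¬ i.1 = y + s := fun h => hy (by rw [h, add_sub_cancel_right])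
    simp [this]
  · simp

/-- **Form bound for a monomial** with coefficient entries `|Δ_x(a,b)| ≤ E(x)`:
`|⟨w, (Z ⊗ Γ) w⟩| ≤ 4N Σ_x (E x + E (x − s)) Σ_{a,α} |w(x,a,α)|²`. -/
theorem norm_form_mon_le (s : TorusSite 4 L) (Δ : TorusSite 4 L → Matrix (Fin N) (Fin N) ℂ)
    (Γ : Matrix (Fin 4) (Fin 4) ℂ) (hΓ : ∀ α β, ‖Γ α β‖ ≤ 1) (E : TorusSite 4 L → ℝ)
    (hE : ∀ x a b, ‖Δ x a b‖ ≤ E x) (w : (TorusSite 4 L × Fin N) × Fin 4 → ℂ) :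
    ‖star w ⬝ᵥ (((Matrix.of fun p q : TorusSite 4 L × Fin N =>
        if q.1 = p.1 + s then Δ p.1 p.2 q.2 else 0) ⊗ₖ Γ) *ᵥ w)‖ ≤
      4 * N * ∑ x, (E x + E (x - s)) * ∑ a, ∑ α, ‖w ((x, a), α)‖ ^ 2 := by
  refine (stub_naiveKineticSchur _ Γ hΓ w).trans ?_
  have key : ∀ x : TorusSite 4 L,
      (∑ a : Fin N, ((∑ j, ‖(Matrix.of fun p q : TorusSite 4 L × Fin N =>
          if q.1 = p.1 + s then Δ p.1 p.2 q.2 else 0) (x, a) j‖) +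
          ∑ j, ‖(Matrix.of fun p q : TorusSite 4 L × Fin N =>
            if q.1 = p.1 + s then Δ p.1 p.2 q.2 else 0) j (x, a)‖) *
              ∑ α, ‖w ((x, a), α)‖ ^ 2) ≤
        N * ((E x + E (x - s)) * ∑ a, ∑ α, ‖w ((x, a), α)‖ ^ 2) := by
    intro x
    rw [Finset.mul_sum, Finset.mul_sum]
    refine Finset.sum_le_sum fun a _ => ?_
    rw [sum_norm_mon_row, sum_norm_mon_col]
    have h1 : ∑ b, ‖Δ x a b‖ ≤ N * E x :=
      (Finset.sum_le_sum fun b _ => hE x a b).trans (by simp)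
    have h2 : ∑ b, ‖Δ (x - s) b a‖ ≤ N * E (x - s) :=
      (Finset.sum_le_sum fun b _ => hE (x - s) b a).trans (by simp)
    have h0 : 0 ≤ ∑ α, ‖w ((x, a), α)‖ ^ 2 := Finset.sum_nonneg fun _ _ => sq_nonneg _
    calc (∑ b, ‖Δ x a b‖ + ∑ b, ‖Δ (x - s) b a‖) * ∑ α, ‖w ((x, a), α)‖ ^ 2
        ≤ (N * E x + N * E (x - s)) * ∑ α, ‖w ((x, a), α)‖ ^ 2 :=
          mul_le_mul_of_nonneg_right (add_le_add h1 h2) h0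
      _ = N * ((E x + E (x - s)) * ∑ α, ‖w ((x, a), α)‖ ^ 2) := by ring
  rw [Fintype.sum_prod_type]
  calc 4 * ∑ x, ∑ a, ((∑ j, ‖(Matrix.of fun p q : TorusSite 4 L × Fin N =>
          if q.1 = p.1 + s then Δ p.1 p.2 q.2 else 0) (x, a) j‖) +
          ∑ j, ‖(Matrix.of fun p q : TorusSite 4 L × Fin N =>
            if q.1 = p.1 + s then Δ p.1 p.2 q.2 else 0) j (x, a)‖) * ∑ α, ‖w ((x, a), α)‖ ^ 2
      ≤ 4 * ∑ x, N * ((E x + E (x - s)) * ∑ a, ∑ α, ‖w ((x, a), α)‖ ^ 2) :=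
        mul_le_mul_of_nonneg_left (Finset.sum_le_sum fun x _ => key x) (by norm_num)
    _ = 4 * N * ∑ x, (E x + E (x - s)) * ∑ a, ∑ α, ‖w ((x, a), α)‖ ^ 2 := by
        rw [mul_assoc, Finset.mul_sum, Finset.mul_sum, Finset.mul_sum]

/-- `F_μ F_ν` is the monomial with offset `μ̂ + ν̂` and coefficient `ρ(U(x,μ)) ρ(U(x+μ̂,ν))`. -/
theorem linkHop_mul_linkHop (U : GaugeConfig 4 L G) (μ ν : Fin 4) :
    linkHop ρ U μ * linkHop ρ U ν = Matrix.of fun p q : TorusSite 4 L × Fin N =>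
      if q.1 = p.1 + ((Pi.single μ 1 : TorusSite 4 L) + (Pi.single ν 1 : TorusSite 4 L)) then
        (ρ (U (p.1, μ)) * ρ (U (p.1 + (Pi.single μ 1 : TorusSite 4 L), ν))) p.2 q.2 else 0 := by
  rw [linkHop_eq_mon, linkHop_eq_mon]
  have h := mon_mul (s := (Pi.single μ 1 : TorusSite 4 L)) (t := (Pi.single ν 1 : TorusSite 4 L))
    (Δ := fun x => ρ (U (x, μ))) (E := fun x => ρ (U (x, ν)))
  rw [h]

/-- `F_μ F_νᴴ` is the monomial with offset `μ̂ − ν̂` and coefficient `ρ(U(x,μ)) ρ(U(x+μ̂−ν̂,ν))ᴴ`. -/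
theorem linkHop_mul_linkHop_conjTranspose (U : GaugeConfig 4 L G) (μ ν : Fin 4) :
    linkHop ρ U μ * (linkHop ρ U ν)ᴴ = Matrix.of fun p q : TorusSite 4 L × Fin N =>
      if q.1 = p.1 + ((Pi.single μ 1 : TorusSite 4 L) - (Pi.single ν 1 : TorusSite 4 L)) then
        (ρ (U (p.1, μ)) *
          (ρ (U (p.1 + (Pi.single μ 1 : TorusSite 4 L) - (Pi.single ν 1 : TorusSite 4 L), ν)))ᴴ)
          p.2 q.2 else 0 := by
  rw [linkHop_eq_mon, linkHop_eq_mon, mon_conjTranspose (Δ := fun x => ρ (U (x, ν)))]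
  have h := mon_mul (s := (Pi.single μ 1 : TorusSite 4 L)) (t := -(Pi.single ν 1 : TorusSite 4 L))
    (Δ := fun x => ρ (U (x, μ))) (E := fun x => (ρ (U (x - (Pi.single ν 1 : TorusSite 4 L), ν)))ᴴ)
  rw [h, ← sub_eq_add_neg]

/-- `F_νᴴ F_μ` is the monomial with offset `μ̂ − ν̂` and coefficient `ρ(U(x−ν̂,ν))ᴴ ρ(U(x−ν̂,μ))`. -/
theorem linkHop_conjTranspose_mul_linkHop (U : GaugeConfig 4 L G) (μ ν : Fin 4) :
    (linkHop ρ U ν)ᴴ * linkHop ρ U μ = Matrix.of fun p q : TorusSite 4 L × Fin N =>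
      if q.1 = p.1 + ((Pi.single μ 1 : TorusSite 4 L) - (Pi.single ν 1 : TorusSite 4 L)) then
        ((ρ (U (p.1 - (Pi.single ν 1 : TorusSite 4 L), ν)))ᴴ *
          ρ (U (p.1 - (Pi.single ν 1 : TorusSite 4 L), μ))) p.2 q.2 else 0 := by
  rw [linkHop_eq_mon, linkHop_eq_mon, mon_conjTranspose (Δ := fun x => ρ (U (x, ν)))]
  have h := mon_mul (s := -(Pi.single ν 1 : TorusSite 4 L)) (t := (Pi.single μ 1 : TorusSite 4 L))
    (Δ := fun x => (ρ (U (x - (Pi.single ν 1 : TorusSite 4 L), ν)))ᴴ) (E := fun x => ρ (U (x, μ)))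
  rw [h]
  simp only [neg_add_eq_sub, ← sub_eq_add_neg]

/-- **The commutator `[F_μ, F_ν]` is a plaquette defect**: the monomial with offset `μ̂ + ν̂` and
coefficient `(ρ(U_{x,μν}) − 1) · ρ(U(x,ν)) ρ(U(x+ν̂,μ))`. -/
theorem linkHop_comm_linkHop (U : GaugeConfig 4 L G) (μ ν : Fin 4) :
    linkHop ρ U μ * linkHop ρ U ν - linkHop ρ U ν * linkHop ρ U μ =
      Matrix.of fun p q : TorusSite 4 L × Fin N =>
        if q.1 = p.1 + ((Pi.single μ 1 : TorusSite 4 L) + (Pi.single ν 1 : TorusSite 4 L)) then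
          ((ρ (plaquetteHolonomy U p.1 μ ν) - 1) *
            (ρ (U (p.1, ν)) * ρ (U (p.1 + (Pi.single ν 1 : TorusSite 4 L), μ)))) p.2 q.2
        else 0 := by
  have hinv : ∀ g : G, ρ g⁻¹ * ρ g = 1 := fun g => by rw [← map_mul, inv_mul_cancel, map_one]
  have key : ∀ x : TorusSite 4 L,
      ρ (U (x, μ)) * ρ (U (x + (Pi.single μ 1 : TorusSite 4 L), ν)) -
          ρ (U (x, ν)) * ρ (U (x + (Pi.single ν 1 : TorusSite 4 L), μ)) =
        (ρ (plaquetteHolonomy U x μ ν) - 1) *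
          (ρ (U (x, ν)) * ρ (U (x + (Pi.single ν 1 : TorusSite 4 L), μ))) := by
    intro x
    rw [plaquetteHolonomy, map_mul, map_mul, map_mul, sub_mul, one_mul,
      QuantumFieldTheory.Site.shift, QuantumFieldTheory.Site.shift]
    congr 1
    simp only [mul_assoc]
    rw [← mul_assoc (ρ (U (x, ν))⁻¹), hinv, one_mul, hinv, mul_one]
  rw [linkHop_mul_linkHop, linkHop_mul_linkHop,
    add_comm (Pi.single ν 1 : TorusSite 4 L) (Pi.single μ 1 : TorusSite 4 L)]
  ext p q
  simp only [Matrix.sub_apply, Matrix.of_apply]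
  split_ifs
  · rw [← key, Matrix.sub_apply]
  · simp

/-- **The commutator `[F_μ, F_νᴴ]` is a plaquette defect**: the monomial with offset `μ̂ − ν̂` and
coefficient `ρ(U(y,ν))ᴴ (ρ(U_{y,νμ}) − 1) ρ(U(y,μ))`, `y = x − ν̂`. -/
theorem linkHop_comm_linkHop_conjTranspose (hρ : ∀ g, ρ g ∈ Matrix.unitaryGroup (Fin N) ℂ)
    (U : GaugeConfig 4 L G) (μ ν : Fin 4) :
    linkHop ρ U μ * (linkHop ρ U ν)ᴴ - (linkHop ρ U ν)ᴴ * linkHop ρ U μ =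
      Matrix.of fun p q : TorusSite 4 L × Fin N =>
        if q.1 = p.1 + ((Pi.single μ 1 : TorusSite 4 L) - (Pi.single ν 1 : TorusSite 4 L)) then
          ((ρ (U (p.1 - (Pi.single ν 1 : TorusSite 4 L), ν)))ᴴ *
            (ρ (plaquetteHolonomy U (p.1 - (Pi.single ν 1 : TorusSite 4 L)) ν μ) - 1) *
              ρ (U (p.1 - (Pi.single ν 1 : TorusSite 4 L), μ))) p.2 q.2
        else 0 := by
  have hinv : ∀ g : G, ρ g⁻¹ * ρ g = 1 := fun g => by rw [← map_mul, inv_mul_cancel, map_one]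
  have hstar : ∀ g : G, (ρ g)ᴴ = ρ g⁻¹ := fun g => by
    rw [← star_eq_conjTranspose, star_rep_eq_rep_inv ρ hρ]
  have key : ∀ x : TorusSite 4 L,
      ρ (U (x, μ)) * (ρ (U (x + (Pi.single μ 1 : TorusSite 4 L) - (Pi.single ν 1 : TorusSite 4 L),
          ν)))ᴴ - (ρ (U (x - (Pi.single ν 1 : TorusSite 4 L), ν)))ᴴ *
            ρ (U (x - (Pi.single ν 1 : TorusSite 4 L), μ)) =
        (ρ (U (x - (Pi.single ν 1 : TorusSite 4 L), ν)))ᴴ *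
          (ρ (plaquetteHolonomy U (x - (Pi.single ν 1 : TorusSite 4 L)) ν μ) - 1) *
            ρ (U (x - (Pi.single ν 1 : TorusSite 4 L), μ)) := by
    intro x
    rw [plaquetteHolonomy, map_mul, map_mul, map_mul, QuantumFieldTheory.Site.shift,
      QuantumFieldTheory.Site.shift, sub_add_cancel, sub_add_eq_add_sub]
    simp only [hstar]
    rw [mul_sub, mul_one, sub_mul]
    congr 1
    simp only [mul_assoc]
    rw [hinv, mul_one, ← mul_assoc (ρ (U (x - Pi.single ν 1, ν))⁻¹), hinv, one_mul]
  rw [linkHop_mul_linkHop_conjTranspose, linkHop_conjTranspose_mul_linkHop]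
  ext p q
  simp only [Matrix.sub_apply, Matrix.of_apply]
  split_ifs
  · rw [← key, Matrix.sub_apply]
  · simp

end Mon

/-! ## The four commutator forms are paid by the curvature potential -/

section Curvature

variable {L : ℕ} [NeZero L]

/-- A single plaquette term within distance `3` is at most `V(U,x)`. -/
theorem sqrt_defect_le_curv (U : GaugeConfig 4 L ↥(Matrix.specialUnitaryGroup (Fin 3) ℂ))
    (x y : TorusSite 4 L) (hy : torusDist x y ≤ 3) (μ ν : Fin 4) :
    Real.sqrt (3 - ((fundamentalRep (Fin 3)) (plaquetteHolonomy U y μ ν)).trace.re) ≤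
      ∑ y ∈ Finset.univ.filter (fun y : TorusSite 4 L => torusDist x y ≤ 3),
        ∑ μ : Fin 4, ∑ ν : Fin 4,
          Real.sqrt (3 - ((fundamentalRep (Fin 3)) (plaquetteHolonomy U y μ ν)).trace.re) := by
  have hmem : y ∈ Finset.univ.filter (fun y : TorusSite 4 L => torusDist x y ≤ 3) :=
    Finset.mem_filter.mpr ⟨Finset.mem_univ _, hy⟩
  calc Real.sqrt (3 - ((fundamentalRep (Fin 3)) (plaquetteHolonomy U y μ ν)).trace.re)
      ≤ ∑ ν' : Fin 4,
          Real.sqrt (3 - ((fundamentalRep (Fin 3)) (plaquetteHolonomy U y μ ν')).trace.re) :=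
        Finset.single_le_sum (f := fun ν' =>
            Real.sqrt (3 - ((fundamentalRep (Fin 3)) (plaquetteHolonomy U y μ ν')).trace.re))
          (fun _ _ => Real.sqrt_nonneg _) (Finset.mem_univ ν)
    _ ≤ ∑ μ' : Fin 4, ∑ ν' : Fin 4,
          Real.sqrt (3 - ((fundamentalRep (Fin 3)) (plaquetteHolonomy U y μ' ν')).trace.re) :=
        Finset.single_le_sum (f := fun μ' => ∑ ν' : Fin 4,
            Real.sqrt (3 - ((fundamentalRep (Fin 3)) (plaquetteHolonomy U y μ' ν')).trace.re))
          (fun _ _ => Finset.sum_nonneg fun _ _ => Real.sqrt_nonneg _) (Finset.mem_univ μ)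
    _ ≤ _ :=
        Finset.single_le_sum (f := fun y => ∑ μ' : Fin 4, ∑ ν' : Fin 4,
            Real.sqrt (3 - ((fundamentalRep (Fin 3)) (plaquetteHolonomy U y μ' ν')).trace.re))
          (fun _ _ => Finset.sum_nonneg fun _ _ => Finset.sum_nonneg fun _ _ =>
            Real.sqrt_nonneg _) hmem

/-- Final arithmetic of the commutator bounds: `4·3·Σ_x (E x + E (x−s)) N_x ≤ 432 Σ_x V_x N_x` when
`E(x), E(x−s) ≤ 18 V(x)`. -/
theorem sum_defect_le_curv (U : GaugeConfig 4 L ↥(Matrix.specialUnitaryGroup (Fin 3) ℂ))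
    (w : (TorusSite 4 L × Fin 3) × Fin 4 → ℂ) (E : TorusSite 4 L → ℝ) (s : TorusSite 4 L)
    (hE : ∀ x, E x ≤ 18 * ∑ y ∈ Finset.univ.filter (fun y : TorusSite 4 L => torusDist x y ≤ 3),
        ∑ μ : Fin 4, ∑ ν : Fin 4,
          Real.sqrt (3 - ((fundamentalRep (Fin 3)) (plaquetteHolonomy U y μ ν)).trace.re))
    (hE' : ∀ x, E (x - s) ≤
      18 * ∑ y ∈ Finset.univ.filter (fun y : TorusSite 4 L => torusDist x y ≤ 3),
        ∑ μ : Fin 4, ∑ ν : Fin 4,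
          Real.sqrt (3 - ((fundamentalRep (Fin 3)) (plaquetteHolonomy U y μ ν)).trace.re)) :
    4 * ((3 : ℕ) : ℝ) * ∑ x, (E x + E (x - s)) * ∑ a : Fin 3, ∑ α : Fin 4, ‖w ((x, a), α)‖ ^ 2 ≤
      432 * ∑ x : TorusSite 4 L,
        (∑ y ∈ Finset.univ.filter (fun y : TorusSite 4 L => torusDist x y ≤ 3),
          ∑ μ : Fin 4, ∑ ν : Fin 4,
            Real.sqrt (3 - ((fundamentalRep (Fin 3)) (plaquetteHolonomy U y μ ν)).trace.re)) *
          ∑ a : Fin 3, ∑ α : Fin 4, ‖w ((x, a), α)‖ ^ 2 := by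
  rw [show (432 : ℝ) = 4 * ((3 : ℕ) : ℝ) * 36 by norm_num, mul_assoc (4 * ((3 : ℕ) : ℝ)) 36,
    Finset.mul_sum _ _ (36 : ℝ)]
  refine mul_le_mul_of_nonneg_left (Finset.sum_le_sum fun x _ => ?_) (by positivity)
  rw [← mul_assoc]
  exact mul_le_mul_of_nonneg_right (by linarith [hE x, hE' x])
    (Finset.sum_nonneg fun _ _ => Finset.sum_nonneg fun _ _ => sq_nonneg _)

/-- **Commutator form 1** (registered sub-goal of this file):
`|⟨w, ([F_μ, F_ν] ⊗ Γ) w⟩| ≤ 432 Σ_x V(U,x) Σ_{a,α}|w(x,a,α)|²` for `|Γ_{αβ}| ≤ 1`. -/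
theorem stub_naiveKineticDefect : ∀ (L : ℕ) [NeZero L] (U : GaugeConfig 4 L ↥(Matrix.specialUnitaryGroup (Fin 3) ℂ)) (μ ν : Fin 4) (Γ : Matrix (Fin 4) (Fin 4) ℂ), (∀ α β, ‖Γ α β‖ ≤ 1) → ∀ (w : (TorusSite 4 L × Fin 3) × Fin 4 → ℂ), ‖star w ⬝ᵥ (((linkHop (fundamentalRep (Fin 3)) U μ * linkHop (fundamentalRep (Fin 3)) U ν - linkHop (fundamentalRep (Fin 3)) U ν * linkHop (fundamentalRep (Fin 3)) U μ) ⊗ₖ Γ) *ᵥ w)‖ ≤ 432 * ∑ x : TorusSite 4 L, (∑ y ∈ Finset.univ.filter (fun y : TorusSite 4 L => torusDist x y ≤ 3), ∑ μ : Fin 4, ∑ ν : Fin 4, Real.sqrt (3 - ((fundamentalRep (Fin 3)) (plaquetteHolonomy U y μ ν)).trace.re)) * ∑ a : Fin 3, ∑ α : Fin 4, ‖w ((x, a), α)‖ ^ 2 := by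
  intro L _ U μ ν Γ hΓ w
  rw [linkHop_comm_linkHop (fundamentalRep (Fin 3)) U μ ν]
  have hE : ∀ (x : TorusSite 4 L) (a b : Fin 3),
      ‖((fundamentalRep (Fin 3) (plaquetteHolonomy U x μ ν) - 1) *
          (fundamentalRep (Fin 3) (U (x, ν)) *
            fundamentalRep (Fin 3) (U (x + (Pi.single ν 1 : TorusSite 4 L), μ)))) a b‖ ≤
        18 * Real.sqrt (3 - (fundamentalRep (Fin 3) (plaquetteHolonomy U x μ ν)).trace.re) :=
    fun x a b => norm_defect_mul_apply_le _ _ _ a b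
  have h := norm_form_mon_le (N := 3) ((Pi.single μ 1 : TorusSite 4 L) + (Pi.single ν 1 : TorusSite 4 L))
    (fun x => (fundamentalRep (Fin 3) (plaquetteHolonomy U x μ ν) - 1) *
      (fundamentalRep (Fin 3) (U (x, ν)) *
        fundamentalRep (Fin 3) (U (x + (Pi.single ν 1 : TorusSite 4 L), μ))))
    Γ hΓ (fun x => 18 * Real.sqrt (3 - (fundamentalRep (Fin 3) (plaquetteHolonomy U x μ ν)).trace.re))
    hE w
  refine h.trans (sum_defect_le_curv U w _ _ (fun x => ?_) (fun x => ?_))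
  · exact mul_le_mul_of_nonneg_left (sqrt_defect_le_curv U x x (by simp) μ ν) (by norm_num)
  · exact mul_le_mul_of_nonneg_left
      (sqrt_defect_le_curv U x _ (torusDist_sub_single_add_single_le x μ ν) μ ν) (by norm_num)

/-- **Commutator form 2**: `|⟨w, ([F_μ, F_νᴴ] ⊗ Γ) w⟩| ≤ 432 Σ_x V(U,x) Σ_{a,α}|w(x,a,α)|²`. -/
theorem form_comm_conjTranspose_le_curv
    (U : GaugeConfig 4 L ↥(Matrix.specialUnitaryGroup (Fin 3) ℂ)) (μ ν : Fin 4)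
    (Γ : Matrix (Fin 4) (Fin 4) ℂ) (hΓ : ∀ α β, ‖Γ α β‖ ≤ 1)
    (w : (TorusSite 4 L × Fin 3) × Fin 4 → ℂ) :
    ‖star w ⬝ᵥ (((linkHop (fundamentalRep (Fin 3)) U μ * (linkHop (fundamentalRep (Fin 3)) U ν)ᴴ -
        (linkHop (fundamentalRep (Fin 3)) U ν)ᴴ * linkHop (fundamentalRep (Fin 3)) U μ) ⊗ₖ Γ)
          *ᵥ w)‖ ≤
      432 * ∑ x : TorusSite 4 L,
        (∑ y ∈ Finset.univ.filter (fun y : TorusSite 4 L => torusDist x y ≤ 3),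
          ∑ μ : Fin 4, ∑ ν : Fin 4,
            Real.sqrt (3 - ((fundamentalRep (Fin 3)) (plaquetteHolonomy U y μ ν)).trace.re)) *
          ∑ a : Fin 3, ∑ α : Fin 4, ‖w ((x, a), α)‖ ^ 2 := by
  rw [linkHop_comm_linkHop_conjTranspose (fundamentalRep (Fin 3)) fundamentalRep_mem_unitaryGroup
    U μ ν]
  have hE : ∀ (x : TorusSite 4 L) (a b : Fin 3),
      ‖((fundamentalRep (Fin 3) (U (x - (Pi.single ν 1 : TorusSite 4 L), ν)))ᴴ *
          (fundamentalRep (Fin 3) (plaquetteHolonomy U (x - (Pi.single ν 1 : TorusSite 4 L)) ν μ)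
            - 1) * fundamentalRep (Fin 3) (U (x - (Pi.single ν 1 : TorusSite 4 L), μ))) a b‖ ≤
        18 * Real.sqrt (3 - (fundamentalRep (Fin 3)
          (plaquetteHolonomy U (x - (Pi.single ν 1 : TorusSite 4 L)) ν μ)).trace.re) :=
    fun x a b => norm_su3_defect_apply_le _ _ _ _ (Or.inr rfl) a b
  have h := norm_form_mon_le (N := 3) ((Pi.single μ 1 : TorusSite 4 L) - (Pi.single ν 1 : TorusSite 4 L))
    (fun x => (fundamentalRep (Fin 3) (U (x - (Pi.single ν 1 : TorusSite 4 L), ν)))ᴴ *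
      (fundamentalRep (Fin 3) (plaquetteHolonomy U (x - (Pi.single ν 1 : TorusSite 4 L)) ν μ) - 1) *
        fundamentalRep (Fin 3) (U (x - (Pi.single ν 1 : TorusSite 4 L), μ)))
    Γ hΓ (fun x => 18 * Real.sqrt (3 - (fundamentalRep (Fin 3)
      (plaquetteHolonomy U (x - (Pi.single ν 1 : TorusSite 4 L)) ν μ)).trace.re)) hE w
  refine h.trans (sum_defect_le_curv U w _ _ (fun x => ?_) (fun x => ?_))
  · exact mul_le_mul_of_nonneg_left
      (sqrt_defect_le_curv U x _ (torusDist_sub_single_le x ν) ν μ) (by norm_num)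
  · have hx : x - ((Pi.single μ 1 : TorusSite 4 L) - (Pi.single ν 1 : TorusSite 4 L)) -
        (Pi.single ν 1 : TorusSite 4 L) = x - Pi.single μ 1 := by abel
    rw [hx]
    exact mul_le_mul_of_nonneg_left
      (sqrt_defect_le_curv U x _ (torusDist_sub_single_le x μ) ν μ) (by norm_num)

/-- **Commutator form 3**: `|⟨w, ([F_μᴴ, F_ν] ⊗ Γ) w⟩| ≤ 432 Σ_x V(U,x) Σ_{a,α}|w(x,a,α)|²`
(`[F_μᴴ, F_ν] = −[F_ν, F_μᴴ]`). -/
theorem form_conjTranspose_comm_le_curv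
    (U : GaugeConfig 4 L ↥(Matrix.specialUnitaryGroup (Fin 3) ℂ)) (μ ν : Fin 4)
    (Γ : Matrix (Fin 4) (Fin 4) ℂ) (hΓ : ∀ α β, ‖Γ α β‖ ≤ 1)
    (w : (TorusSite 4 L × Fin 3) × Fin 4 → ℂ) :
    ‖star w ⬝ᵥ ((((linkHop (fundamentalRep (Fin 3)) U μ)ᴴ * linkHop (fundamentalRep (Fin 3)) U ν -
        linkHop (fundamentalRep (Fin 3)) U ν * (linkHop (fundamentalRep (Fin 3)) U μ)ᴴ) ⊗ₖ Γ)
          *ᵥ w)‖ ≤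
      432 * ∑ x : TorusSite 4 L,
        (∑ y ∈ Finset.univ.filter (fun y : TorusSite 4 L => torusDist x y ≤ 3),
          ∑ μ : Fin 4, ∑ ν : Fin 4,
            Real.sqrt (3 - ((fundamentalRep (Fin 3)) (plaquetteHolonomy U y μ ν)).trace.re)) *
          ∑ a : Fin 3, ∑ α : Fin 4, ‖w ((x, a), α)‖ ^ 2 := by
  rw [← neg_sub (linkHop (fundamentalRep (Fin 3)) U ν * (linkHop (fundamentalRep (Fin 3)) U μ)ᴴ),
    neg_kronecker, neg_mulVec, dotProduct_neg, norm_neg]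
  exact form_comm_conjTranspose_le_curv U ν μ Γ hΓ w

/-- **Commutator form 4**: `|⟨w, ([F_μᴴ, F_νᴴ] ⊗ Γ) w⟩| ≤ 432 Σ_x V(U,x) Σ_{a,α}|w(x,a,α)|²`
(`[F_μᴴ, F_νᴴ] = −[F_μ, F_ν]ᴴ` and `⟨w, (Zᴴ ⊗ Γ) w⟩ = conj ⟨w, (Z ⊗ Γᴴ) w⟩`). -/
theorem form_conjTranspose_comm_conjTranspose_le_curv
    (U : GaugeConfig 4 L ↥(Matrix.specialUnitaryGroup (Fin 3) ℂ)) (μ ν : Fin 4)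
    (Γ : Matrix (Fin 4) (Fin 4) ℂ) (hΓ : ∀ α β, ‖Γ α β‖ ≤ 1)
    (w : (TorusSite 4 L × Fin 3) × Fin 4 → ℂ) :
    ‖star w ⬝ᵥ ((((linkHop (fundamentalRep (Fin 3)) U μ)ᴴ * (linkHop (fundamentalRep (Fin 3)) U ν)ᴴ
        - (linkHop (fundamentalRep (Fin 3)) U ν)ᴴ * (linkHop (fundamentalRep (Fin 3)) U μ)ᴴ) ⊗ₖ Γ)
          *ᵥ w)‖ ≤
      432 * ∑ x : TorusSite 4 L,
        (∑ y ∈ Finset.univ.filter (fun y : TorusSite 4 L => torusDist x y ≤ 3),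
          ∑ μ : Fin 4, ∑ ν : Fin 4,
            Real.sqrt (3 - ((fundamentalRep (Fin 3)) (plaquetteHolonomy U y μ ν)).trace.re)) *
          ∑ a : Fin 3, ∑ α : Fin 4, ‖w ((x, a), α)‖ ^ 2 := by
  have h : (linkHop (fundamentalRep (Fin 3)) U μ)ᴴ * (linkHop (fundamentalRep (Fin 3)) U ν)ᴴ -
      (linkHop (fundamentalRep (Fin 3)) U ν)ᴴ * (linkHop (fundamentalRep (Fin 3)) U μ)ᴴ =
        -(linkHop (fundamentalRep (Fin 3)) U μ * linkHop (fundamentalRep (Fin 3)) U ν -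
          linkHop (fundamentalRep (Fin 3)) U ν * linkHop (fundamentalRep (Fin 3)) U μ)ᴴ := by
    rw [conjTranspose_sub, conjTranspose_mul, conjTranspose_mul, neg_sub]
  have h2 : (linkHop (fundamentalRep (Fin 3)) U μ * linkHop (fundamentalRep (Fin 3)) U ν -
      linkHop (fundamentalRep (Fin 3)) U ν * linkHop (fundamentalRep (Fin 3)) U μ)ᴴ ⊗ₖ Γ =
        ((linkHop (fundamentalRep (Fin 3)) U μ * linkHop (fundamentalRep (Fin 3)) U ν -
          linkHop (fundamentalRep (Fin 3)) U ν * linkHop (fundamentalRep (Fin 3)) U μ) ⊗ₖ Γᴴ)ᴴ := by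
    rw [conjTranspose_kronecker, conjTranspose_conjTranspose]
  rw [h, neg_kronecker, neg_mulVec, dotProduct_neg, norm_neg, h2, ← star_form, norm_star]
  exact stub_naiveKineticDefect L U μ ν Γᴴ
    (fun α β => by rw [conjTranspose_apply, norm_star]; exact hΓ β α) w

end Curvature

end Summit.QuantumFields.QCD.Cruxes.ActionBoundsLowModes.DropTheWilsonSquare
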